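import Summits.CriticalPhenomena.SAWScalingLimit.Theorems.SAWDevelopingMapNoFoldBoundSealedClasses
import Summits.CriticalPhenomena.SAWScalingLimit.Theorems.SAWDevelopingMapNoFoldBoundSealedAlgebra
import Summits.CriticalPhenomena.SAWScalingLimit.Theorems.SAWDevelopingMapNoFoldBoundInteriorModes
import Summits.CriticalPhenomena.SAWScalingLimit.Theorems.SAWDevelopingMapNoFoldBoundPortRenewal
import Summits.CriticalPhenomena.SAWScalingLimit.Theorems.SAWDevelopingMapNoFoldBoundSlitSC

/-!
# `NoFoldBound`, sealed ports II: slit coherence at a vertex with a sealed neighbour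

Crux `NoFoldBound` (stmt-CriticalPhenomena-8296), route `SAWDevelopingMap`, line `Ideator3Sketch`.
The open stub `stub_slitCoherence` asks for one `k < 1` with `‖B₀ + ωB₁ + ω²B₂‖ ≤ k ‖S₀ + S₁ + S₂‖`
at every interior vertex (positive labelling; `B_j`, `S_j` the first-arrival sums of the slit
source modes). This file PROVES it from the item `SourceLoopBound` on the stratum of interior
vertices with a SEALED neighbour `w` (every neighbour of `w` other than `v` outside `Λ`): if the
source is not at `w` the sealed port is dead and the two live ports carry rigid windings one class
apart (`sealed_classes`), so the sums collapse to `ω e^{-iσW}(B₁ʳ + e^{13πi/12}B₂ʳ)` against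
`e^{-iσW}(S₁ʳ + e^{5πi/12}S₂ʳ)` with real dressed masses `0 ≤ B_jʳ ≤ k S_jʳ` (slit loops `≤ c` by
`SourceLoopBound` in the simply connected slit domains, `dressed_le`) and `two_class_bound`
concludes; if the source is at `w` only the sealed port is live (one-step walk) and the inequality
is the dressed single-arrival bound. Results: `sealed_core` (sealed neighbour in position `w₀`),
`slitCoherence_sealed` (all positions, `k(c) = max(1/2, 1 − m(c)/10) < 1`).
-/

noncomputable section

open scoped BigOperators
open Literature.Probability.LatticeModels Literature.Probability.RandomPlanarGeometry.SAW

namespace Summit.CriticalPhenomena.SAWScalingLimit.Theorems.SAWDevelopingMapNoFoldBound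

/-! ## Restricted first-arrival sums with a real dressing -/

section Sums

variable {Λ : Finset HexVertex} {a z : Sym2 HexVertex}

/-- Phase factorisation of a dressed restricted sum all of whose windings equal `W`. [folklore] -/
theorem sum_ite_weight_mul_eq (P : HexMidEdgeSAW Λ a z → Prop) [DecidablePred P] (W x σ : ℝ)
    (r : HexMidEdgeSAW Λ a z → ℝ) (h : ∀ γ : HexMidEdgeSAW Λ a z, P γ → γ.winding = W) :
    (∑ γ : HexMidEdgeSAW Λ a z, if P γ then γ.weight x σ * ((r γ : ℝ) : ℂ) else 0) =
      Complex.exp (-Complex.I * σ * W) *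
        ((∑ γ : HexMidEdgeSAW Λ a z, if P γ then x ^ γ.length * r γ else 0 : ℝ) : ℂ) := by
  rw [Complex.ofReal_sum, Finset.mul_sum]
  refine Finset.sum_congr rfl fun γ _ => ?_
  by_cases hγ : P γ
  · rw [if_pos hγ, if_pos hγ, HexMidEdgeSAW.weight, h γ hγ]
    push_cast
    ring
  · rw [if_neg hγ, if_neg hγ]
    push_cast
    ring

/-- A dressed restricted sum over an empty restriction vanishes. [folklore] -/
theorem sum_ite_weight_mul_eq_zero (P : HexMidEdgeSAW Λ a z → Prop) [DecidablePred P] (x σ : ℝ)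
    (r : HexMidEdgeSAW Λ a z → ℝ) (h : ∀ γ : HexMidEdgeSAW Λ a z, ¬ P γ) :
    (∑ γ : HexMidEdgeSAW Λ a z, if P γ then γ.weight x σ * ((r γ : ℝ) : ℂ) else 0) = 0 :=
  Finset.sum_eq_zero fun γ _ => if_neg (h γ)

/-- Nonnegativity of a real dressed restricted sum. [folklore] -/
theorem sum_ite_pow_mul_nonneg (P : HexMidEdgeSAW Λ a z → Prop) [DecidablePred P] {x : ℝ}
    (hx : 0 ≤ x) (r : HexMidEdgeSAW Λ a z → ℝ) (h : ∀ γ : HexMidEdgeSAW Λ a z, P γ → 0 ≤ r γ) :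
    0 ≤ ∑ γ : HexMidEdgeSAW Λ a z, if P γ then x ^ γ.length * r γ else 0 :=
  Finset.sum_nonneg fun γ _ => by
    by_cases hγ : P γ
    · rw [if_pos hγ]; exact mul_nonneg (pow_nonneg hx _) (h γ hγ)
    · rw [if_neg hγ]

/-- Comparison of two real dressed restricted sums. [folklore] -/
theorem sum_ite_pow_mul_le (P : HexMidEdgeSAW Λ a z → Prop) [DecidablePred P] {x k : ℝ}
    (hx : 0 ≤ x) (r r' : HexMidEdgeSAW Λ a z → ℝ)
    (h : ∀ γ : HexMidEdgeSAW Λ a z, P γ → r γ ≤ k * r' γ) :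
    (∑ γ : HexMidEdgeSAW Λ a z, if P γ then x ^ γ.length * r γ else 0) ≤
      k * ∑ γ : HexMidEdgeSAW Λ a z, if P γ then x ^ γ.length * r' γ else 0 := by
  rw [Finset.mul_sum]
  refine Finset.sum_le_sum fun γ _ => ?_
  by_cases hγ : P γ
  · rw [if_pos hγ, if_pos hγ]
    have := mul_le_mul_of_nonneg_left (h γ hγ) (pow_nonneg hx γ.length)
    linarith
  · rw [if_neg hγ, if_neg hγ, mul_zero]

/-- A winding phase does not change the norm: `‖e^{-iσW} z‖ = ‖z‖`. [folklore] -/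
theorem norm_phase_mul (σ W : ℝ) (z : ℂ) : ‖Complex.exp (-Complex.I * σ * W) * z‖ = ‖z‖ := by
  rw [norm_mul, show -Complex.I * σ * W = ((-(σ * W) : ℝ) : ℂ) * Complex.I by push_cast; ring,
    Complex.norm_exp_ofReal_mul_I, one_mul]

end Sums

/-! ## The sealed-port core -/

/-- **Sealed core (sealed neighbour in position `w₀`, positive labelling).** Let `Λ` be simply
connected with source `a ∈ ∂Ω`, `v ∈ Λ` an interior vertex off `a` with pairwise distinct
neighbours `w₀, w₁, w₂ ∈ Λ` in the positive order (turn `w₀ → v → w₁ = +π/3`), `w₀` SEALED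
(every neighbour of `w₀` other than `v` outside `Λ`), and suppose the returning-loop series of
`SourceLoopBound` are `≤ c < sin(π/8)` (hypothesis `hSLBc`). Then the slit-coherence inequality
holds at `v` with `k(c) = max(1/2, 1 − m(c)/10)`, `m(c) = (α_T + β_T)·2√3x_c(sin(π/8) − c)`.
[folklore] -/
theorem sealed_core {c : ℝ} (hc : c < Real.sin (Real.pi / 8))
    (hSLBc : ∀ (Λ : Finset HexVertex), hexDomainSimplyConnected Λ →
      ∀ u v w₁ w₂ : HexVertex, u ∉ Λ → v ∈ Λ → hexGraph.Adj v u → hexGraph.Adj v w₁ →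
        hexGraph.Adj v w₂ → u ≠ w₁ → u ≠ w₂ → w₁ ≠ w₂ →
        (∑ γ : HexMidEdgeSAW (Λ.erase v) s(v, w₁) s(v, w₂), hexCriticalFugacity ^ γ.length) ≤ c)
    {Λ : Finset HexVertex} (hΛ : hexDomainSimplyConnected Λ) {a : Sym2 HexVertex}
    (ha : a ∈ hexDomainBoundary Λ) {v : HexVertex} (hv : v ∈ Λ) (hva : v ∉ a)
    {w₀ w₁ w₂ : HexVertex} (h₀ : hexGraph.Adj v w₀) (h₁ : hexGraph.Adj v w₁)
    (h₂ : hexGraph.Adj v w₂) (h₀₁ : w₀ ≠ w₁) (h₁₂ : w₁ ≠ w₂) (h₀₂ : w₀ ≠ w₂) (hw₀ : w₀ ∈ Λ)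
    (hchir : winding [hexMidpoint s(w₀, v), hexCenter v, hexMidpoint s(v, w₁)] = Real.pi / 3)
    (hseal : ∀ y : HexVertex, hexGraph.Adj w₀ y → y ≠ v → y ∉ Λ) :
    let x : ℝ := hexCriticalFugacity
    let α : ℝ := 1 + 2 * hexCriticalFugacity * Real.cos (5 * Real.pi / 24)
    let β : ℝ := 1 + 2 * hexCriticalFugacity * Real.cos (11 * Real.pi / 24)
    let ω : ℂ := Complex.exp (2 * Real.pi * Complex.I / 3)
    let Z : (w p q : HexVertex) → HexMidEdgeSAW Λ a s(v, w) → ℝ :=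
      fun w p q (γ : HexMidEdgeSAW Λ a s(v, w)) =>
      ∑ δ : HexMidEdgeSAW ((Λ \ γ.verts.toFinset).erase v) s(v, p) s(v, q), x ^ δ.length
    let B : (w p q : HexVertex) → ℂ := fun w p q =>
      ∑ γ : HexMidEdgeSAW Λ a s(v, w), if v ∉ γ.verts then
        γ.weight x (5 / 8) * ((β + Real.sqrt 3 * x * Z w p q γ : ℝ) : ℂ) else 0
    let S : (w p q : HexVertex) → ℂ := fun w p q =>
      ∑ γ : HexMidEdgeSAW Λ a s(v, w), if v ∉ γ.verts then
        γ.weight x (5 / 8) * ((α - Real.sqrt 3 * x * Z w p q γ : ℝ) : ℂ) else 0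
    ‖B w₀ w₁ w₂ + ω * B w₁ w₂ w₀ + ω ^ 2 * B w₂ w₀ w₁‖ ≤
      max (1 / 2) (1 - (α + β) * (2 * Real.sqrt 3 * hexCriticalFugacity *
        (Real.sin (Real.pi / 8) - c)) / 10) * ‖S w₀ w₁ w₂ + S w₁ w₂ w₀ + S w₂ w₀ w₁‖ := by
  dsimp only
  -- the turns at `v` from the chirality
  obtain ⟨ε, hε, T01, -, T20, T10, -, -⟩ := stub_localTurns v w₀ w₁ w₂ h₀ h₁ h₂ h₀₁ h₁₂ h₀₂
  have hε1 : ε = 1 := by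
    rcases hε with h | h
    · exact h
    · exfalso
      rw [h] at T01
      have := Real.pi_pos
      linarith [T01.symm.trans hchir]
  subst hε1
  simp only [one_mul] at T20 T10
  set x := hexCriticalFugacity with hx
  set α : ℝ := 1 + 2 * x * Real.cos (5 * Real.pi / 24) with hα
  set β : ℝ := 1 + 2 * x * Real.cos (11 * Real.pi / 24) with hβ
  set ω : ℂ := Complex.exp (2 * Real.pi * Complex.I / 3) with hω
  set K : ℝ := max (1 / 2) (1 - (α + β) * (2 * Real.sqrt 3 * x *
    (Real.sin (Real.pi / 8) - c)) / 10) with hK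
  have hK0 : 0 ≤ K := le_trans (by norm_num) (le_max_left _ _)
  have x0 : 0 ≤ x := nfb_xc_pos.le
  have hβ0 : 0 ≤ β := nfb_betaT_nonneg
  have hω1 : ‖ω‖ = 1 := norm_omega
  -- the six sums
  set S0 := ∑ γ : HexMidEdgeSAW Λ a s(v, w₀), if v ∉ γ.verts then γ.weight x (5 / 8) * ((α - Real.sqrt 3 * x *
    ∑ δ : HexMidEdgeSAW ((Λ \ γ.verts.toFinset).erase v) s(v, w₁) s(v, w₂), x ^ δ.length : ℝ) : ℂ) else 0 with hS0
  set S1 := ∑ γ : HexMidEdgeSAW Λ a s(v, w₁), if v ∉ γ.verts then γ.weight x (5 / 8) * ((α - Real.sqrt 3 * x *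
    ∑ δ : HexMidEdgeSAW ((Λ \ γ.verts.toFinset).erase v) s(v, w₂) s(v, w₀), x ^ δ.length : ℝ) : ℂ) else 0 with hS1
  set S2 := ∑ γ : HexMidEdgeSAW Λ a s(v, w₂), if v ∉ γ.verts then γ.weight x (5 / 8) * ((α - Real.sqrt 3 * x *
    ∑ δ : HexMidEdgeSAW ((Λ \ γ.verts.toFinset).erase v) s(v, w₀) s(v, w₁), x ^ δ.length : ℝ) : ℂ) else 0 with hS2
  set B0 := ∑ γ : HexMidEdgeSAW Λ a s(v, w₀), if v ∉ γ.verts then γ.weight x (5 / 8) * ((β + Real.sqrt 3 * x *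
    ∑ δ : HexMidEdgeSAW ((Λ \ γ.verts.toFinset).erase v) s(v, w₁) s(v, w₂), x ^ δ.length : ℝ) : ℂ) else 0 with hB0
  set B1 := ∑ γ : HexMidEdgeSAW Λ a s(v, w₁), if v ∉ γ.verts then γ.weight x (5 / 8) * ((β + Real.sqrt 3 * x *
    ∑ δ : HexMidEdgeSAW ((Λ \ γ.verts.toFinset).erase v) s(v, w₂) s(v, w₀), x ^ δ.length : ℝ) : ℂ) else 0 with hB1
  set B2 := ∑ γ : HexMidEdgeSAW Λ a s(v, w₂), if v ∉ γ.verts then γ.weight x (5 / 8) * ((β + Real.sqrt 3 * x *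
    ∑ δ : HexMidEdgeSAW ((Λ \ γ.verts.toFinset).erase v) s(v, w₀) s(v, w₁), x ^ δ.length : ℝ) : ℂ) else 0 with hB2
  -- slit loop bounds from `SourceLoopBound` (slit domains are simply connected)
  have loop_bd : ∀ (e p q : HexVertex), hexGraph.Adj v e → hexGraph.Adj v p → hexGraph.Adj v q →
      e ≠ p → e ≠ q → p ≠ q → ∀ γ : HexMidEdgeSAW Λ a s(v, e), v ∉ γ.verts →
      0 ≤ ∑ δ : HexMidEdgeSAW ((Λ \ γ.verts.toFinset).erase v) s(v, p) s(v, q), x ^ δ.length ∧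
      (∑ δ : HexMidEdgeSAW ((Λ \ γ.verts.toFinset).erase v) s(v, p) s(v, q), x ^ δ.length) ≤ c := by
    intro e p q he hp hq hep heq hpq γ hγ
    refine ⟨Finset.sum_nonneg fun δ _ => pow_nonneg x0 _, ?_⟩
    have heγ : e ∈ γ.verts := mem_verts_of_firstArrival hva γ hγ
    have he' : e ∉ Λ \ γ.verts.toFinset := fun h =>
      (Finset.mem_sdiff.1 h).2 (List.mem_toFinset.2 heγ)
    have hv' : v ∈ Λ \ γ.verts.toFinset :=
      Finset.mem_sdiff.2 ⟨hv, fun h => hγ (List.mem_toFinset.1 h)⟩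
    exact hSLBc _ (stub_slitSC Λ hΛ a ha _ γ) e v p q he' hv' he hp hq hep heq hpq
  -- termwise dressed bounds
  have term_bd : ∀ Zγ : ℝ, 0 ≤ Zγ → Zγ ≤ c →
      0 ≤ β + Real.sqrt 3 * x * Zγ ∧ 0 ≤ α - Real.sqrt 3 * x * Zγ ∧
      β + Real.sqrt 3 * x * Zγ ≤ K * (α - Real.sqrt 3 * x * Zγ) := by
    intro Zγ hZ0 hZc
    obtain ⟨hle, hS0⟩ := dressed_le hc hZ0 hZc
    exact ⟨by positivity, hS0, hle⟩
  by_cases hwa : w₀ ∈ a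
  · /- the source is at the sealed neighbour: only the sealed port is live -/
    have E1S : S1 = 0 := sum_ite_weight_mul_eq_zero _ x (5 / 8) _ fun γ => not_not.2 (mem_verts_of_sealed_source ha hw₀ hwa hva hseal h₀₁.symm γ)
    have E2S : S2 = 0 := sum_ite_weight_mul_eq_zero _ x (5 / 8) _ fun γ => not_not.2 (mem_verts_of_sealed_source ha hw₀ hwa hva hseal h₀₂.symm γ)
    have E1B : B1 = 0 := sum_ite_weight_mul_eq_zero _ x (5 / 8) _ fun γ => not_not.2 (mem_verts_of_sealed_source ha hw₀ hwa hva hseal h₀₁.symm γ)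
    have E2B : B2 = 0 := sum_ite_weight_mul_eq_zero _ x (5 / 8) _ fun γ => not_not.2 (mem_verts_of_sealed_source ha hw₀ hwa hva hseal h₀₂.symm γ)
    -- the first arrivals at the sealed port are the one-step walk: common winding
    set W₀ : ℝ := winding [hexMidpoint a, hexCenter w₀, hexMidpoint s(v, w₀)] with hW₀
    have hW : ∀ γ : HexMidEdgeSAW Λ a s(v, w₀), v ∉ γ.verts → γ.winding = W₀ := by
      intro γ hγ
      have hverts := verts_eq_of_sealed_source ha hw₀ hwa hva γ hγ
      rw [HexMidEdgeSAW.winding, HexMidEdgeSAW.points, hverts]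
      rfl
    set b₀ : ℝ := ∑ γ : HexMidEdgeSAW Λ a s(v, w₀), if v ∉ γ.verts then x ^ γ.length *
      (β + Real.sqrt 3 * x *
        ∑ δ : HexMidEdgeSAW ((Λ \ γ.verts.toFinset).erase v) s(v, w₁) s(v, w₂),
          x ^ δ.length) else 0 with hb₀
    set s₀ : ℝ := ∑ γ : HexMidEdgeSAW Λ a s(v, w₀), if v ∉ γ.verts then x ^ γ.length *
      (α - Real.sqrt 3 * x *
        ∑ δ : HexMidEdgeSAW ((Λ \ γ.verts.toFinset).erase v) s(v, w₁) s(v, w₂),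
          x ^ δ.length) else 0 with hs₀
    have E0S : S0 = Complex.exp (-Complex.I * (5 / 8 : ℝ) * W₀) * (s₀ : ℂ) :=
      sum_ite_weight_mul_eq _ W₀ x (5 / 8) _ hW
    have E0B : B0 = Complex.exp (-Complex.I * (5 / 8 : ℝ) * W₀) * (b₀ : ℂ) :=
      sum_ite_weight_mul_eq _ W₀ x (5 / 8) _ hW
    have L0 := fun (γ : HexMidEdgeSAW Λ a s(v, w₀)) (hγ : v ∉ γ.verts) =>
      loop_bd w₀ w₁ w₂ h₀ h₁ h₂ h₀₁ h₀₂ h₁₂ γ hγ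
    have hb0 : 0 ≤ b₀ := sum_ite_pow_mul_nonneg _ x0 _ fun γ hγ => (term_bd _ (L0 γ hγ).1 (L0 γ hγ).2).1
    have hs0 : 0 ≤ s₀ := sum_ite_pow_mul_nonneg _ x0 _ fun γ hγ => (term_bd _ (L0 γ hγ).1 (L0 γ hγ).2).2.1
    have hbs0 : b₀ ≤ K * s₀ := sum_ite_pow_mul_le _ x0 _ _ fun γ hγ => (term_bd _ (L0 γ hγ).1 (L0 γ hγ).2).2.2
    rw [E1S, E2S, E1B, E2B, E0S, E0B, mul_zero, mul_zero, add_zero, add_zero, add_zero, add_zero,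
      norm_phase_mul, norm_phase_mul, Complex.norm_real,
      Complex.norm_real, Real.norm_of_nonneg hb0, Real.norm_of_nonneg hs0]
    exact hbs0
  · /- the source is not at the sealed neighbour: the sealed port is dead, the two live ports
      carry rigid windings one class apart -/
    have E0S : S0 = 0 := sum_ite_weight_mul_eq_zero _ x (5 / 8) _ fun γ => not_not.2 (mem_verts_of_sealed hva hwa hseal γ)
    have E0B : B0 = 0 := sum_ite_weight_mul_eq_zero _ x (5 / 8) _ fun γ => not_not.2 (mem_verts_of_sealed hva hwa hseal γ)
    -- an outside neighbour of `w₀` and the rigidity of the classes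
    obtain ⟨x₀, hx₀, hx₀v⟩ := exists_adj_ne w₀ v
    have hcls := fun (p p' : HexVertex) (hp : hexGraph.Adj v p) (hp' : hexGraph.Adj v p')
      (hpw : p ≠ w₀) (hp'w : p' ≠ w₀) (γ : HexMidEdgeSAW Λ a s(v, p))
      (γ' : HexMidEdgeSAW Λ a s(v, p')) (hγ : v ∉ γ.verts) (hγ' : v ∉ γ'.verts) =>
      sealed_classes hΛ ha hv hva hw₀ hwa h₀ hseal hx₀ hx₀v hp hp' hpw hp'w γ γ' hγ hγ'
    have hW : ∃ W : ℝ, (∀ γ : HexMidEdgeSAW Λ a s(v, w₁), v ∉ γ.verts → γ.winding = W) ∧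
        (∀ γ : HexMidEdgeSAW Λ a s(v, w₂), v ∉ γ.verts →
          γ.winding = W + -(2 * Real.pi / 3)) := by
      by_cases hex₁ : ∃ γ₁ : HexMidEdgeSAW Λ a s(v, w₁), v ∉ γ₁.verts
      · obtain ⟨γ₁, hγ₁⟩ := hex₁
        refine ⟨γ₁.winding, fun γ hγ => ?_, fun γ hγ => ?_⟩
        · have h := hcls w₁ w₁ h₁ h₁ h₀₁.symm h₀₁.symm γ γ₁ hγ hγ₁
          linarith
        · have h := hcls w₁ w₂ h₁ h₂ h₀₁.symm h₀₂.symm γ₁ γ hγ₁ hγ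
          rw [T10, T20] at h
          linarith
      · push Not at hex₁
        by_cases hex₂ : ∃ γ₂ : HexMidEdgeSAW Λ a s(v, w₂), v ∉ γ₂.verts
        · obtain ⟨γ₂, hγ₂⟩ := hex₂
          refine ⟨γ₂.winding + 2 * Real.pi / 3, fun γ hγ => absurd (hex₁ γ) hγ, fun γ hγ => ?_⟩
          have h := hcls w₂ w₂ h₂ h₂ h₀₂.symm h₀₂.symm γ γ₂ hγ hγ₂
          linarith
        · push Not at hex₂
          exact ⟨0, fun γ hγ => absurd (hex₁ γ) hγ, fun γ hγ => absurd (hex₂ γ) hγ⟩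
    obtain ⟨W, hW₁, hW₂⟩ := hW
    -- the real dressed masses and their bounds
    set b₁ : ℝ := ∑ γ : HexMidEdgeSAW Λ a s(v, w₁), if v ∉ γ.verts then x ^ γ.length *
      (β + Real.sqrt 3 * x *
        ∑ δ : HexMidEdgeSAW ((Λ \ γ.verts.toFinset).erase v) s(v, w₂) s(v, w₀),
          x ^ δ.length) else 0 with hb₁
    set s₁ : ℝ := ∑ γ : HexMidEdgeSAW Λ a s(v, w₁), if v ∉ γ.verts then x ^ γ.length *
      (α - Real.sqrt 3 * x *
        ∑ δ : HexMidEdgeSAW ((Λ \ γ.verts.toFinset).erase v) s(v, w₂) s(v, w₀),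
          x ^ δ.length) else 0 with hs₁
    set b₂ : ℝ := ∑ γ : HexMidEdgeSAW Λ a s(v, w₂), if v ∉ γ.verts then x ^ γ.length *
      (β + Real.sqrt 3 * x *
        ∑ δ : HexMidEdgeSAW ((Λ \ γ.verts.toFinset).erase v) s(v, w₀) s(v, w₁),
          x ^ δ.length) else 0 with hb₂
    set s₂ : ℝ := ∑ γ : HexMidEdgeSAW Λ a s(v, w₂), if v ∉ γ.verts then x ^ γ.length *
      (α - Real.sqrt 3 * x *
        ∑ δ : HexMidEdgeSAW ((Λ \ γ.verts.toFinset).erase v) s(v, w₀) s(v, w₁),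
          x ^ δ.length) else 0 with hs₂
    -- phase factorisations
    have E1S : S1 = Complex.exp (-Complex.I * (5 / 8 : ℝ) * W) * (s₁ : ℂ) :=
      sum_ite_weight_mul_eq _ W x (5 / 8) _ hW₁
    have E1B : B1 = Complex.exp (-Complex.I * (5 / 8 : ℝ) * W) * (b₁ : ℂ) :=
      sum_ite_weight_mul_eq _ W x (5 / 8) _ hW₁
    have E2S : S2 =
        Complex.exp (-Complex.I * (5 / 8 : ℝ) * ((W + -(2 * Real.pi / 3) : ℝ) : ℂ)) * (s₂ : ℂ) :=
      sum_ite_weight_mul_eq _ (W + -(2 * Real.pi / 3)) x (5 / 8) _ hW₂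
    have E2B : B2 =
        Complex.exp (-Complex.I * (5 / 8 : ℝ) * ((W + -(2 * Real.pi / 3) : ℝ) : ℂ)) * (b₂ : ℂ) :=
      sum_ite_weight_mul_eq _ (W + -(2 * Real.pi / 3)) x (5 / 8) _ hW₂
    have L1 := fun (γ : HexMidEdgeSAW Λ a s(v, w₁)) (hγ : v ∉ γ.verts) =>
      loop_bd w₁ w₂ w₀ h₁ h₂ h₀ h₁₂ h₀₁.symm h₀₂.symm γ hγ
    have L2 := fun (γ : HexMidEdgeSAW Λ a s(v, w₂)) (hγ : v ∉ γ.verts) =>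
      loop_bd w₂ w₀ w₁ h₂ h₀ h₁ h₀₂.symm h₁₂.symm h₀₁ γ hγ
    have hb₁0 : 0 ≤ b₁ := sum_ite_pow_mul_nonneg _ x0 _ fun γ hγ => (term_bd _ (L1 γ hγ).1 (L1 γ hγ).2).1
    have hs₁0 : 0 ≤ s₁ := sum_ite_pow_mul_nonneg _ x0 _ fun γ hγ => (term_bd _ (L1 γ hγ).1 (L1 γ hγ).2).2.1
    have hb₂0 : 0 ≤ b₂ := sum_ite_pow_mul_nonneg _ x0 _ fun γ hγ => (term_bd _ (L2 γ hγ).1 (L2 γ hγ).2).1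
    have hs₂0 : 0 ≤ s₂ := sum_ite_pow_mul_nonneg _ x0 _ fun γ hγ => (term_bd _ (L2 γ hγ).1 (L2 γ hγ).2).2.1
    have hbs₁ : b₁ ≤ K * s₁ := sum_ite_pow_mul_le _ x0 _ _ fun γ hγ => (term_bd _ (L1 γ hγ).1 (L1 γ hγ).2).2.2
    have hbs₂ : b₂ ≤ K * s₂ := sum_ite_pow_mul_le _ x0 _ _ fun γ hγ => (term_bd _ (L2 γ hγ).1 (L2 γ hγ).2).2.2
    -- the two phases
    set P : ℂ := ω * Complex.exp (Complex.I * (5 / 8 : ℝ) * ((2 * Real.pi / 3 : ℝ) : ℂ)) with hP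
    set Q : ℂ := Complex.exp (Complex.I * (5 / 8 : ℝ) * ((2 * Real.pi / 3 : ℝ) : ℂ)) with hQ
    have hPe : P = Complex.exp ((13 * Real.pi / 12 : ℝ) * Complex.I) := by
      rw [hP, hω]; exact omega_mul_exp_sigma
    have hQe : Q = Complex.exp ((5 * Real.pi / 12 : ℝ) * Complex.I) := by
      rw [hQ]; exact exp_sigma_eq
    have hPn : ‖P‖ ≤ 1 := by rw [hPe, Complex.norm_exp_ofReal_mul_I]
    have hPre : P.re ≤ -(1 / 2) := by rw [hPe]; exact re_expI_thirteen_pi_div_twelve_le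
    have hQn : ‖Q‖ = 1 := by rw [hQe, Complex.norm_exp_ofReal_mul_I]
    have hQre : 0 ≤ Q.re := by rw [hQe]; exact re_expI_five_pi_div_twelve_nonneg
    have key := two_class_bound hb₁0 hb₂0 hs₁0 hs₂0 hK0 hbs₁ hbs₂ hPn hPre hQn hQre
    -- assemble
    set e : ℂ := Complex.exp (-Complex.I * (5 / 8 : ℝ) * W) with he
    rw [E0S, E0B, E1S, E1B, E2S, E2B, exp_sub_phase]
    have eL : (0 : ℂ) + ω * (e * (b₁ : ℂ)) + ω ^ 2 * (e * Q * (b₂ : ℂ)) =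
        ω * (e * ((b₁ : ℂ) + P * b₂)) := by rw [hP]; ring
    have eR : (0 : ℂ) + e * (s₁ : ℂ) + e * Q * (s₂ : ℂ) = e * ((s₁ : ℂ) + Q * s₂) := by ring
    rw [eL, eR, norm_mul, hω1, one_mul, norm_phase_mul, norm_phase_mul]
    exact key

/-! ## All positions of the sealed neighbour -/

/-- Cyclic rotation of the labelling does not change the Beltrami norm (`ω³ = 1`, `|ω| = 1`).
[folklore] -/
theorem norm_rotate (X₀ X₁ X₂ : ℂ) :
    ‖X₀ + Complex.exp (2 * Real.pi * Complex.I / 3) * X₁ +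
        Complex.exp (2 * Real.pi * Complex.I / 3) ^ 2 * X₂‖ =
      ‖X₁ + Complex.exp (2 * Real.pi * Complex.I / 3) * X₂ +
        Complex.exp (2 * Real.pi * Complex.I / 3) ^ 2 * X₀‖ := by
  set ω : ℂ := Complex.exp (2 * Real.pi * Complex.I / 3) with hω
  have hω3 : ω ^ 3 = 1 := omega_pow_three
  have hω1 : ‖ω‖ = 1 := norm_omega
  rw [show X₀ + ω * X₁ + ω ^ 2 * X₂ = ω * (X₁ + ω * X₂ + ω ^ 2 * X₀) by
    linear_combination (-X₀) * hω3, norm_mul, hω1, one_mul]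

/-- The constant `k(c) = max(1/2, 1 − m(c)/10)` is `< 1` for `c < sin(π/8)`. [folklore] -/
theorem sealedConst_lt_one {c : ℝ} (hc : c < Real.sin (Real.pi / 8)) :
    max (1 / 2) (1 - ((1 + 2 * hexCriticalFugacity * Real.cos (5 * Real.pi / 24)) +
      (1 + 2 * hexCriticalFugacity * Real.cos (11 * Real.pi / 24))) *
      (2 * Real.sqrt 3 * hexCriticalFugacity * (Real.sin (Real.pi / 8) - c)) / 10) < 1 :=
  max_lt (by norm_num) (by linarith [margin_pos hc])

/-- **Slit coherence on the sealed-port stratum.** `SourceLoopBound` implies the slit-coherence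
inequality of the open stub `stub_slitCoherence` — with one `k < 1` — at every interior vertex
`v` (off the source mid-edge, all neighbours in `Λ`) that has a SEALED neighbour `w` (every
neighbour of `w` other than `v` outside `Λ`), for every positive labelling. The sealed neighbour
is one of `w₀, w₁, w₂` (`adj_cases`); the three positions are `sealed_core` for the three cyclic
rotations of the labelling (all positive), whose Beltrami norms agree (`norm_rotate`).
[folklore] -/
theorem slitCoherence_sealed
    (hSLB : Summit.CriticalPhenomena.SAWScalingLimit.Theses.SAWDevelopingMap.SourceLoopBound) :
    ∃ k : ℝ, k < 1 ∧ ∀ (Λ : Finset HexVertex), hexDomainSimplyConnected Λ →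
      ∀ a ∈ hexDomainBoundary Λ, ∀ v ∈ Λ, v ∉ a → (∀ u : HexVertex, hexGraph.Adj v u → u ∈ Λ) →
      (∃ w : HexVertex, hexGraph.Adj v w ∧ ∀ y : HexVertex, hexGraph.Adj w y → y ≠ v → y ∉ Λ) →
      ∀ w₀ w₁ w₂ : HexVertex, hexGraph.Adj v w₀ → hexGraph.Adj v w₁ → hexGraph.Adj v w₂ →
      w₀ ≠ w₁ → w₁ ≠ w₂ → w₀ ≠ w₂ →
      winding [hexMidpoint s(w₀, v), hexCenter v, hexMidpoint s(v, w₁)] = Real.pi / 3 →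
      let x : ℝ := hexCriticalFugacity
      let α : ℝ := 1 + 2 * hexCriticalFugacity * Real.cos (5 * Real.pi / 24)
      let β : ℝ := 1 + 2 * hexCriticalFugacity * Real.cos (11 * Real.pi / 24)
      let ω : ℂ := Complex.exp (2 * Real.pi * Complex.I / 3)
      let Z : (w p q : HexVertex) → HexMidEdgeSAW Λ a s(v, w) → ℝ :=
        fun w p q (γ : HexMidEdgeSAW Λ a s(v, w)) =>
        ∑ δ : HexMidEdgeSAW ((Λ \ γ.verts.toFinset).erase v) s(v, p) s(v, q), x ^ δ.length
      let B : (w p q : HexVertex) → ℂ := fun w p q =>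
        ∑ γ : HexMidEdgeSAW Λ a s(v, w), if v ∉ γ.verts then
          γ.weight x (5 / 8) * ((β + Real.sqrt 3 * x * Z w p q γ : ℝ) : ℂ) else 0
      let S : (w p q : HexVertex) → ℂ := fun w p q =>
        ∑ γ : HexMidEdgeSAW Λ a s(v, w), if v ∉ γ.verts then
          γ.weight x (5 / 8) * ((α - Real.sqrt 3 * x * Z w p q γ : ℝ) : ℂ) else 0
      ‖B w₀ w₁ w₂ + ω * B w₁ w₂ w₀ + ω ^ 2 * B w₂ w₀ w₁‖ ≤
        k * ‖S w₀ w₁ w₂ + S w₁ w₂ w₀ + S w₂ w₀ w₁‖ := by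
  obtain ⟨c, hc, hSLBc⟩ := hSLB
  refine ⟨_, sealedConst_lt_one hc, ?_⟩
  intro Λ hΛ a ha v hv hva hint hsealed w₀ w₁ w₂ h₀ h₁ h₂ h₀₁ h₁₂ h₀₂ hchir
  dsimp only
  obtain ⟨w, hvw, hseal⟩ := hsealed
  have hwΛ : w ∈ Λ := hint w hvw
  -- the other two positive chiralities
  obtain ⟨ε, hε, T01, T12, T20, -, -, -⟩ := stub_localTurns v w₀ w₁ w₂ h₀ h₁ h₂ h₀₁ h₁₂ h₀₂
  have hε1 : ε = 1 := by
    rcases hε with h | h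
    · exact h
    · exfalso
      rw [h] at T01
      have := Real.pi_pos
      linarith [T01.symm.trans hchir]
  subst hε1
  simp only [one_mul] at T12 T20
  rcases adj_cases h₀ h₁ h₂ h₀₁ h₁₂ h₀₂ hvw with rfl | rfl | rfl
  · have h := sealed_core hc hSLBc hΛ ha hv hva h₀ h₁ h₂ h₀₁ h₁₂ h₀₂ hwΛ hchir hseal
    dsimp only at h
    exact h
  · have h := sealed_core hc hSLBc hΛ ha hv hva h₁ h₂ h₀ h₁₂ h₀₂.symm h₀₁.symm hwΛ T12 hseal
    dsimp only at h
    rw [norm_rotate]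
    convert h using 3
    ring
  · have h := sealed_core hc hSLBc hΛ ha hv hva h₂ h₀ h₁ h₀₂.symm h₀₁ h₁₂.symm hwΛ T20 hseal
    dsimp only at h
    rw [norm_rotate, norm_rotate]
    convert h using 3
    ring

end Summit.CriticalPhenomena.SAWScalingLimit.Theorems.SAWDevelopingMapNoFoldBound

end
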